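import Summits.NavierStokesRegularity.NavierStokesRegularity.Theorems.TypeIliouvilleNoTypeII.Negative.NSISuperCascadeNoAtom
import HarnessLib

/-!
# The super-similar NSI cascade on the Euler scaling line: power exponent `ρ`, discrete
self-similarity, and the two-regime bookkeeping lemma

Negative-lane support file for `stmt-NavierStokesRegularity-0056`
(`Summit.NavierStokesRegularity.NavierStokesRegularity.Theses.TypeILiouville.TypeIliouvilleNoTypeII`),
bearing on the §B route `EulerZoomLiouville` (crux `PowerGaugeEulerLiouville`, items
`TypeIOrPowerZoomable` / `SereginZoomReduction`): it places the model class M2′ — the super-similar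
NSI cascades `glueG T σ τ a z u` of an `IsSuperBlock` datum (`NSISuperCascadePieces`,
`NSISuperCascadePortrait.exists_weakNSI_blowup_exact_rate`) — on SEREGIN'S EULER SCALING LINE.

* **Dictionary.** With `a = τ^{-(1+ρ)}` (`gain_eq_rpow`: `ρ = log_{τ⁻¹} a - 1`), the covariance
  law `aσ² = τ` and the strict cap `τ⁻¹ < a`, `a²τ³ < 1` read `σ² = τ^{2+ρ}`, `0 < ρ < 1/2`,
  `a²τ³ = τ^{1-2ρ}`, `aτ² = τ^{1-ρ}`, `aτ⁻¹ = τ^{-(2+ρ)}`, `a²τ⁴ = τ^{2-2ρ}` (the strip ratios of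
  `|𝔲|²`, `|D𝔲|²`, `|𝔲|³`, `NSISuperCascadeStrips`), and the exponents of `NSISuperCascadeRateWindow`
  become `β = log_{σ⁻²} a = (1+ρ)/(2+ρ)`, `γ = log_{σ⁻²} τ⁻¹ = 1/(2+ρ)` — Seregin's power-zoomable
  Type-II portrait `|v| ≲ (T₀-t)^{-(1+ρ)/(2+ρ)}` on balls of radius `(T₀-t)^{1/(2+ρ)}`
  [arXiv:2402.13229, (1.7); arXiv:2409.07625, Thm. 1.3 / (3.1)], whose window `0 < ρ ≤ 1/2` is the
  reach `β ∈ (1/2, 3/5]` of `NSISuperCascadeReach`.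
* **Discrete Euler self-similarity** (`glueG_eulerDSS`, `glueG_eulerDSS_rpow`): about its blow-up
  point `(T₀, x₀)` the cascade is invariant under Seregin's Euler scaling of exponent `ρ` at the
  discrete scale `λ = τ`:  `τ^{1+ρ} 𝔲(T₀ - τ^{2+ρ} s, x₀ + τ y) = 𝔲(T₀ - s, x₀ + y)` (`s ≤ T₀`).
* **Two-regime bookkeeping** (`crossover_min_le`, `crossover_sum_le`, `crossover_tsum_le`): pieces
  LARGER than a ball are counted by volume × sup, SMALLER ones by their total integral:
  `Σ_j min(α (τʲ)^{e₁}, β r^{e₁+e₂} (τʲ)^{-e₂}) ≤ (α/(1-τ^{e₁}) + β/(1-τ^{e₂})) r^{e₁}`; the companion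
  file `NSISuperCascadePowerGauges` feeds the strip integrals through it (gauges `r^{2ρ}A`, `r^{ρ}E`).

WHAT THIS IS NOT: nothing about Navier–Stokes or Euler SOLUTIONS — the cascade solves the NS
INEQUALITY only (`isWeakNSISolution_glueG`); kill-kit reading: M2′ realises the power-zoomable
Type-II portrait inside the NSI class, so excluding that portrait must use the identity, not only the
local energy inequality and gauge bookkeeping. Pure arithmetic plus the strip structure; no definitions.

References: W. S. Ożański, arXiv:1709.00602 (2017), §2 [`Ozanski2017NSISingular`]; G. Seregin,
arXiv:2402.13229 (2024), (1.7)–(1.8); arXiv:2409.07625 (2024), Def. 1.1, Thm. 1.3, (3.1).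
-/

noncomputable section

open MeasureTheory Set Function Filter Topology Metric
open scoped ENNReal

set_option linter.dupNamespace false

namespace Summit.NavierStokesRegularity.NavierStokesRegularity.Theorems.TypeIliouvilleNoTypeIINegative

open Literature.Analysis.FluidPDE Literature.Barriers.NavierStokesRegularity
open Literature.Barriers.NavierStokesRegularity.Scheffer

/-! ### Elementary `rpow` bookkeeping -/

/-- `(τⁿ)^e = (τ^e)ⁿ` for `τ ≥ 0`. [folklore] -/
theorem pow_rpow_comm {τ : ℝ} (hτ : 0 ≤ τ) (n : ℕ) (e : ℝ) : (τ ^ n) ^ e = (τ ^ e) ^ n := by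
  rw [← Real.rpow_natCast_mul hτ, mul_comm, Real.rpow_mul_natCast hτ]

/-! ### The two-regime bookkeeping lemma -/

/-- **Pointwise two-regime bound**: for `s, r > 0`, `e₁, e₂ ≥ 0`, `α, β ≥ 0`,
`min(α s^{e₁}, β r^{e₁+e₂} s^{-e₂}) ≤ (α + β) r^{e₁}` (first branch if `s ≤ r`, second if
`r < s`, where `r^{e₁+e₂}s^{-e₂} = r^{e₁}(r/s)^{e₂} ≤ r^{e₁}`). [folklore] -/
theorem crossover_min_le {s r e₁ e₂ α β : ℝ} (hs : 0 < s) (hr : 0 < r) (he₁ : 0 ≤ e₁)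
    (he₂ : 0 ≤ e₂) (hα : 0 ≤ α) (hβ : 0 ≤ β) :
    min (α * s ^ e₁) (β * (r ^ (e₁ + e₂) * s ^ (-e₂))) ≤ (α + β) * r ^ e₁ := by
  have hr1 : 0 ≤ r ^ e₁ := Real.rpow_nonneg hr.le _
  rcases le_or_gt s r with hsr | hrs
  · calc min (α * s ^ e₁) (β * (r ^ (e₁ + e₂) * s ^ (-e₂))) ≤ α * s ^ e₁ := min_le_left _ _
      _ ≤ α * r ^ e₁ := mul_le_mul_of_nonneg_left (Real.rpow_le_rpow hs.le hsr he₁) hα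
      _ ≤ (α + β) * r ^ e₁ := by nlinarith
  · have h1 : r ^ (e₁ + e₂) * s ^ (-e₂) = r ^ e₁ * (r / s) ^ e₂ := by
      rw [Real.rpow_add hr, Real.div_rpow hr.le hs.le, Real.rpow_neg hs.le]
      ring
    have h2 : (r / s) ^ e₂ ≤ 1 :=
      Real.rpow_le_one (div_nonneg hr.le hs.le) ((div_le_one hs).2 hrs.le) he₂
    calc min (α * s ^ e₁) (β * (r ^ (e₁ + e₂) * s ^ (-e₂)))
        ≤ β * (r ^ (e₁ + e₂) * s ^ (-e₂)) := min_le_right _ _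
      _ = β * r ^ e₁ * (r / s) ^ e₂ := by rw [h1, mul_assoc]
      _ ≤ β * r ^ e₁ * 1 := mul_le_mul_of_nonneg_left h2 (mul_nonneg hβ hr1)
      _ ≤ (α + β) * r ^ e₁ := by nlinarith

/-- **Summed two-regime bound** (partial sums): for `0 < τ < 1`, `r > 0`, `e₁, e₂ > 0`,
`α, β ≥ 0` and every `N`,
`Σ_{j<N} min(α (τʲ)^{e₁}, β r^{e₁+e₂} (τʲ)^{-e₂}) ≤ (α/(1-τ^{e₁}) + β/(1-τ^{e₂})) r^{e₁}`:
with `j₀` the least index with `τ^{j₀} ≤ r`, the indices `j ≥ j₀` contribute the geometric tail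
`α r^{e₁} Σ_k (τ^{e₁})^k` and the indices `j < j₀` (where `τʲ > r`) the reversed geometric sum
`β r^{e₁} Σ_k (τ^{e₂})^k`. [folklore] -/
theorem crossover_sum_le {τ r e₁ e₂ α β : ℝ} (hτ₀ : 0 < τ) (hτ₁ : τ < 1) (hr : 0 < r)
    (he₁ : 0 < e₁) (he₂ : 0 < e₂) (hα : 0 ≤ α) (hβ : 0 ≤ β) (N : ℕ) :
    ∑ j ∈ Finset.range N, min (α * (τ ^ j) ^ e₁) (β * (r ^ (e₁ + e₂) * (τ ^ j) ^ (-e₂))) ≤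
      (α / (1 - τ ^ e₁) + β / (1 - τ ^ e₂)) * r ^ e₁ := by
  classical
  -- the crossover index
  have hex : ∃ j : ℕ, τ ^ j ≤ r := by
    obtain ⟨n, hn⟩ := exists_pow_lt_of_lt_one hr hτ₁
    exact ⟨n, hn.le⟩
  set j₀ := Nat.find hex with hj₀def
  have hj₀ : τ ^ j₀ ≤ r := Nat.find_spec hex
  have hlt : ∀ j, j < j₀ → r < τ ^ j := fun j hj => not_le.1 (Nat.find_min hex hj)
  -- the two geometric ratios
  set x := τ ^ e₁ with hx
  set y := τ ^ e₂ with hy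
  have hx0 : 0 ≤ x := Real.rpow_nonneg hτ₀.le _
  have hy0 : 0 ≤ y := Real.rpow_nonneg hτ₀.le _
  have hx1 : x < 1 := Real.rpow_lt_one hτ₀.le hτ₁ he₁
  have hy1 : y < 1 := Real.rpow_lt_one hτ₀.le hτ₁ he₂
  have hre₁ : 0 ≤ r ^ e₁ := Real.rpow_nonneg hr.le _
  -- termwise bounds
  set F : ℕ → ℝ := fun j => if j₀ ≤ j then α * r ^ e₁ * x ^ (j - j₀) else β * r ^ e₁ * y ^ (j₀ - 1 - j)
    with hF
  have hterm : ∀ j, min (α * (τ ^ j) ^ e₁) (β * (r ^ (e₁ + e₂) * (τ ^ j) ^ (-e₂))) ≤ F j := by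
    intro j
    by_cases hj : j₀ ≤ j
    · -- small pieces: `(τʲ)^{e₁} = (τ^{j₀})^{e₁} (τ^{e₁})^{j-j₀} ≤ r^{e₁} x^{j-j₀}`
      rw [hF]; simp only [if_pos hj]
      refine (min_le_left _ _).trans ?_
      have e : (τ ^ j) ^ e₁ = (τ ^ j₀) ^ e₁ * x ^ (j - j₀) := by
        rw [hx, ← pow_rpow_comm hτ₀.le, ← Real.mul_rpow (pow_nonneg hτ₀.le _) (pow_nonneg hτ₀.le _),
          ← pow_add, Nat.add_sub_cancel' hj]
      rw [e, mul_assoc]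
      exact mul_le_mul_of_nonneg_left (mul_le_mul_of_nonneg_right
        (Real.rpow_le_rpow (pow_nonneg hτ₀.le _) hj₀ he₁.le) (pow_nonneg hx0 _)) hα
    · -- large pieces: `j < j₀`, `τ^{j₀-1} > r`, `(τʲ)^{-e₂} = (τ^{j₀-1})^{-e₂} (τ^{e₂})^{j₀-1-j}`
      rw [hF]; simp only [if_neg hj]
      rw [not_le] at hj
      refine (min_le_right _ _).trans ?_
      have hj1 : j ≤ j₀ - 1 := Nat.le_sub_one_of_lt hj
      have hj₀1 : j₀ - 1 < j₀ := Nat.sub_one_lt (Nat.ne_zero_of_lt hj)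
      have hbig : r < τ ^ (j₀ - 1) := hlt _ hj₀1
      have e : (τ ^ j) ^ (-e₂) = (τ ^ (j₀ - 1)) ^ (-e₂) * y ^ (j₀ - 1 - j) := by
        have hsplit : τ ^ (j₀ - 1) = τ ^ j * τ ^ (j₀ - 1 - j) := by
          rw [← pow_add, Nat.add_sub_cancel' hj1]
        rw [hsplit, Real.mul_rpow (pow_nonneg hτ₀.le _) (pow_nonneg hτ₀.le _), hy,
          ← pow_rpow_comm hτ₀.le, mul_assoc, ← Real.rpow_add (pow_pos hτ₀ _), neg_add_cancel,
          Real.rpow_zero, mul_one]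
      have h1 : (τ ^ (j₀ - 1)) ^ (-e₂) ≤ r ^ (-e₂) :=
        Real.rpow_le_rpow_of_nonpos hr hbig.le (by linarith)
      have h2 : r ^ (e₁ + e₂) * r ^ (-e₂) = r ^ e₁ := by
        rw [← Real.rpow_add hr]; ring_nf
      calc β * (r ^ (e₁ + e₂) * (τ ^ j) ^ (-e₂))
          = β * r ^ (e₁ + e₂) * ((τ ^ (j₀ - 1)) ^ (-e₂) * y ^ (j₀ - 1 - j)) := by rw [e, mul_assoc]
        _ ≤ β * r ^ (e₁ + e₂) * (r ^ (-e₂) * y ^ (j₀ - 1 - j)) :=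
            mul_le_mul_of_nonneg_left (mul_le_mul_of_nonneg_right h1 (pow_nonneg hy0 _))
              (mul_nonneg hβ (Real.rpow_nonneg hr.le _))
        _ = β * r ^ e₁ * y ^ (j₀ - 1 - j) := by rw [← mul_assoc, mul_assoc β, h2]
  -- sum the bounds
  have hsumx : ∑ j ∈ (Finset.range N).filter (fun j => j₀ ≤ j), x ^ (j - j₀) ≤ (1 - x)⁻¹ := by
    rw [← Finset.sum_image (f := fun k => x ^ k) (s := (Finset.range N).filter (fun j => j₀ ≤ j))
      (g := fun j => j - j₀) ?_]
    · rw [← tsum_geometric_of_lt_one hx0 hx1]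
      exact (summable_geometric_of_lt_one hx0 hx1).sum_le_tsum _ (fun k _ => pow_nonneg hx0 _)
    · intro i hi j hj hij
      simp only [Finset.coe_filter, Finset.mem_range, mem_setOf_eq] at hi hj
      simp only at hij
      omega
  have hsumy : ∑ j ∈ (Finset.range N).filter (fun j => ¬ j₀ ≤ j), y ^ (j₀ - 1 - j) ≤ (1 - y)⁻¹ := by
    rw [← Finset.sum_image (f := fun k => y ^ k) (s := (Finset.range N).filter (fun j => ¬ j₀ ≤ j))
      (g := fun j => j₀ - 1 - j) ?_]
    · rw [← tsum_geometric_of_lt_one hy0 hy1]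
      exact (summable_geometric_of_lt_one hy0 hy1).sum_le_tsum _ (fun k _ => pow_nonneg hy0 _)
    · intro i hi j hj hij
      simp only [Finset.coe_filter, Finset.mem_range, mem_setOf_eq] at hi hj
      simp only at hij
      omega
  calc ∑ j ∈ Finset.range N, min (α * (τ ^ j) ^ e₁) (β * (r ^ (e₁ + e₂) * (τ ^ j) ^ (-e₂)))
      ≤ ∑ j ∈ Finset.range N, F j := Finset.sum_le_sum fun j _ => hterm j
    _ = (∑ j ∈ (Finset.range N).filter (fun j => j₀ ≤ j), α * r ^ e₁ * x ^ (j - j₀)) +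
          ∑ j ∈ (Finset.range N).filter (fun j => ¬ j₀ ≤ j), β * r ^ e₁ * y ^ (j₀ - 1 - j) := by
        rw [hF, Finset.sum_ite]
    _ = α * r ^ e₁ * (∑ j ∈ (Finset.range N).filter (fun j => j₀ ≤ j), x ^ (j - j₀)) +
          β * r ^ e₁ * ∑ j ∈ (Finset.range N).filter (fun j => ¬ j₀ ≤ j), y ^ (j₀ - 1 - j) := by
        rw [Finset.mul_sum, Finset.mul_sum]
    _ ≤ α * r ^ e₁ * (1 - x)⁻¹ + β * r ^ e₁ * (1 - y)⁻¹ :=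
        add_le_add (mul_le_mul_of_nonneg_left hsumx (mul_nonneg hα hre₁))
          (mul_le_mul_of_nonneg_left hsumy (mul_nonneg hβ hre₁))
    _ = (α / (1 - τ ^ e₁) + β / (1 - τ ^ e₂)) * r ^ e₁ := by rw [hx, hy]; ring

/-- **Summed two-regime bound in `ℝ≥0∞`**: a sequence dominated by both branches has
`Σ' f ≤ (α/(1-τ^{e₁}) + β/(1-τ^{e₂})) r^{e₁}`. [folklore] -/
theorem crossover_tsum_le {τ r e₁ e₂ α β : ℝ} {f : ℕ → ℝ≥0∞} (hτ₀ : 0 < τ) (hτ₁ : τ < 1)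
    (hr : 0 < r) (he₁ : 0 < e₁) (he₂ : 0 < e₂) (hα : 0 ≤ α) (hβ : 0 ≤ β)
    (h₁ : ∀ j, f j ≤ ENNReal.ofReal (α * (τ ^ j) ^ e₁))
    (h₂ : ∀ j, f j ≤ ENNReal.ofReal (β * (r ^ (e₁ + e₂) * (τ ^ j) ^ (-e₂)))) :
    ∑' j, f j ≤ ENNReal.ofReal ((α / (1 - τ ^ e₁) + β / (1 - τ ^ e₂)) * r ^ e₁) := by
  refine ENNReal.tsum_le_of_sum_range_le fun N => ?_
  have hnn : ∀ j, 0 ≤ min (α * (τ ^ j) ^ e₁) (β * (r ^ (e₁ + e₂) * (τ ^ j) ^ (-e₂))) := fun j =>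
    le_min (mul_nonneg hα (Real.rpow_nonneg (pow_nonneg hτ₀.le _) _))
      (mul_nonneg hβ (mul_nonneg (Real.rpow_nonneg hr.le _) (Real.rpow_nonneg (pow_nonneg hτ₀.le _) _)))
  calc ∑ j ∈ Finset.range N, f j
      ≤ ∑ j ∈ Finset.range N,
          ENNReal.ofReal (min (α * (τ ^ j) ^ e₁) (β * (r ^ (e₁ + e₂) * (τ ^ j) ^ (-e₂)))) :=
        Finset.sum_le_sum fun j _ => by
          rw [ENNReal.ofReal_min]
          exact le_min (h₁ j) (h₂ j)
    _ = ENNReal.ofReal (∑ j ∈ Finset.range N,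
          min (α * (τ ^ j) ^ e₁) (β * (r ^ (e₁ + e₂) * (τ ^ j) ^ (-e₂)))) :=
        (ENNReal.ofReal_sum_of_nonneg fun j _ => hnn j).symm
    _ ≤ _ := ENNReal.ofReal_le_ofReal (crossover_sum_le hτ₀ hτ₁ hr he₁ he₂ hα hβ N)

namespace IsSuperBlock

variable {T ν₀ τ σ a : ℝ} {z : EuclideanSpace ℝ (Fin 3)} {G : Set (EuclideanSpace ℝ (Fin 3))}
  {u : ℝ → EuclideanSpace ℝ (Fin 3) → EuclideanSpace ℝ (Fin 3)} {ρ : ℝ}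

/-! ### The power exponent `ρ`: `a = τ^{-(1+ρ)}` -/

/-- **The power exponent exists**: `a = τ^{-(1+ρ)}` with `ρ = log_{τ⁻¹} a - 1`. [folklore] -/
theorem gain_eq_rpow (h : IsSuperBlock T ν₀ τ σ a z G u) :
    a = τ ^ (-(1 + (Real.logb τ⁻¹ a - 1))) := by
  have hτ := h.τ_pos
  rw [show 1 + (Real.logb τ⁻¹ a - 1) = Real.logb τ⁻¹ a by ring, Real.rpow_neg hτ.le,
    ← Real.inv_rpow hτ.le, Real.rpow_logb (inv_pos.2 hτ) h.one_lt_inv_tau.ne' h.gain_pos]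

/-- `aʲ = τ^{-(1+ρ) j}`. [folklore] -/
theorem gain_pow_eq_rpow (h : IsSuperBlock T ν₀ τ σ a z G u) (hρ : a = τ ^ (-(1 + ρ))) (j : ℕ) :
    a ^ j = (τ ^ j) ^ (-(1 + ρ)) := by
  rw [hρ, pow_rpow_comm h.τ_pos.le]

/-- **`0 < ρ`** (the super-gain `τ⁻¹ < a`, i.e. the Type-II threshold `1 < aσ`). [folklore] -/
theorem powerExp_pos (h : IsSuperBlock T ν₀ τ σ a z G u) (hρ : a = τ ^ (-(1 + ρ))) : 0 < ρ := by
  by_contra hle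
  rw [not_lt] at hle
  have h1 : τ ^ (-(1 + ρ)) ≤ τ ^ (-1 : ℝ) :=
    Real.rpow_le_rpow_of_exponent_ge h.τ_pos h.τ_lt_one.le (by linarith)
  rw [← hρ, Real.rpow_neg_one] at h1
  exact absurd h.inv_lt (not_lt.2 h1)

/-- The energy ratio of the strips: `a²τ³ = τ^{1-2ρ}`. [folklore] -/
theorem energyRatio_eq_rpow (h : IsSuperBlock T ν₀ τ σ a z G u) (hρ : a = τ ^ (-(1 + ρ))) :
    a ^ 2 * τ ^ 3 = τ ^ (1 - 2 * ρ) := by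
  have hτ := h.τ_pos
  rw [hρ, ← Real.rpow_mul_natCast hτ.le, ← Real.rpow_natCast τ 3, ← Real.rpow_add hτ]
  congr 1; push_cast; ring

/-- **`ρ < 1/2`** (the strict energy cap `a²τ³ < 1` of `NSIBlockStrictGain`). [folklore] -/
theorem powerExp_lt_half (h : IsSuperBlock T ν₀ τ σ a z G u) (hρ : a = τ ^ (-(1 + ρ))) :
    ρ < 1 / 2 := by
  by_contra hle
  rw [not_lt] at hle
  have h1 : 1 ≤ τ ^ (1 - 2 * ρ) :=
    Real.one_le_rpow_of_pos_of_le_one_of_nonpos h.τ_pos h.τ_lt_one.le (by linarith)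
  rw [← h.energyRatio_eq_rpow hρ] at h1
  exact absurd h.cap_lt_one (not_lt.2 h1)

/-- The dissipation ratio of the strips: `aτ² = τ^{1-ρ}`. [folklore] -/
theorem gain_mul_sq_eq_rpow (h : IsSuperBlock T ν₀ τ σ a z G u) (hρ : a = τ ^ (-(1 + ρ))) :
    a * τ ^ 2 = τ ^ (1 - ρ) := by
  have hτ := h.τ_pos
  rw [hρ, ← Real.rpow_natCast τ 2, ← Real.rpow_add hτ]
  congr 1; push_cast; ring

/-- The `L³` ratio of the strips: `a²τ⁴ = τ^{2-2ρ}`. [folklore] -/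
theorem gain_sq_mul_pow_four_eq_rpow (h : IsSuperBlock T ν₀ τ σ a z G u)
    (hρ : a = τ ^ (-(1 + ρ))) : a ^ 2 * τ ^ 4 = τ ^ (2 - 2 * ρ) := by
  have hτ := h.τ_pos
  rw [hρ, ← Real.rpow_mul_natCast hτ.le, ← Real.rpow_natCast τ 4, ← Real.rpow_add hτ]
  congr 1; push_cast; ring

/-- The clock-to-length ratio: `aτ⁻¹ = τ^{-(2+ρ)}` (`= σ⁻²`). [folklore] -/
theorem gain_mul_inv_eq_rpow (h : IsSuperBlock T ν₀ τ σ a z G u) (hρ : a = τ ^ (-(1 + ρ))) :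
    a * τ⁻¹ = τ ^ (-(2 + ρ)) := by
  have hτ := h.τ_pos
  rw [hρ, ← Real.rpow_neg_one, ← Real.rpow_add hτ]
  congr 1; ring

/-- **The parabolic clock on the Euler line**: `σ² = τ^{2+ρ}` (time scale `λ^{2+ρ}` for length
scale `λ = τ`). [folklore] -/
theorem σ_sq_eq_rpow (h : IsSuperBlock T ν₀ τ σ a z G u) (hρ : a = τ ^ (-(1 + ρ))) :
    σ ^ 2 = τ ^ (2 + ρ) := by
  have hτ := h.τ_pos
  have e : τ ^ (2 + ρ) = τ * τ ^ (1 + ρ) := by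
    rw [show (2 : ℝ) + ρ = 1 + (1 + ρ) by ring, Real.rpow_add hτ, Real.rpow_one]
  rw [e, h.σ_sq, hρ, Real.rpow_neg hτ.le, div_eq_mul_inv, inv_inv]

/-- `σ⁻² = τ^{-(2+ρ)}`. [folklore] -/
theorem inv_σ_sq_eq_rpow (h : IsSuperBlock T ν₀ τ σ a z G u) (hρ : a = τ ^ (-(1 + ρ))) :
    (σ⁻¹) ^ 2 = τ ^ (-(2 + ρ)) := by
  rw [inv_pow, h.σ_sq_eq_rpow hρ, Real.rpow_neg h.τ_pos.le]

/-- `σ^{2j} = (τʲ)^{2+ρ}`. [folklore] -/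
theorem σ_pow_two_mul_eq_rpow (h : IsSuperBlock T ν₀ τ σ a z G u) (hρ : a = τ ^ (-(1 + ρ)))
    (j : ℕ) : σ ^ (2 * j) = (τ ^ j) ^ (2 + ρ) := by
  rw [pow_mul, h.σ_sq_eq_rpow hρ, pow_rpow_comm h.τ_pos.le]

/-- **Seregin's amplitude exponent**: the rate exponent `β = log_{σ⁻²} a` of
`NSISuperCascadeRateWindow` / `exists_rate_glueG` equals `(1+ρ)/(2+ρ)`. [folklore] -/
theorem rateExp_eq_of_powerExp (h : IsSuperBlock T ν₀ τ σ a z G u) (hρ : a = τ ^ (-(1 + ρ))) :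
    Real.logb ((σ⁻¹) ^ 2) a = (1 + ρ) / (2 + ρ) := by
  have hl : Real.log τ ≠ 0 := Real.log_ne_zero_of_pos_of_ne_one h.τ_pos h.τ_lt_one.ne
  have h2 : (2 : ℝ) + ρ ≠ 0 := by linarith [h.powerExp_pos hρ]
  rw [Real.logb, h.inv_σ_sq_eq_rpow hρ, hρ, Real.log_rpow h.τ_pos, Real.log_rpow h.τ_pos]
  field_simp

/-- **Seregin's length exponent**: `γ = log_{σ⁻²} τ⁻¹ = 1/(2+ρ)`. [folklore] -/
theorem lengthExp_eq_of_powerExp (h : IsSuperBlock T ν₀ τ σ a z G u) (hρ : a = τ ^ (-(1 + ρ))) :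
    Real.logb ((σ⁻¹) ^ 2) τ⁻¹ = 1 / (2 + ρ) := by
  have hl : Real.log τ ≠ 0 := Real.log_ne_zero_of_pos_of_ne_one h.τ_pos h.τ_lt_one.ne
  have h2 : (2 : ℝ) + ρ ≠ 0 := by linarith [h.powerExp_pos hρ]
  rw [Real.logb, h.inv_σ_sq_eq_rpow hρ, Real.log_rpow h.τ_pos, Real.log_inv]
  field_simp

/-! ### Discrete Euler self-similarity about the blow-up point -/

/-- `t_k = T₀ - σ^{2k} T₀`. [folklore] -/
theorem switchTime_eq_blowupTime_sub (h : IsSuperBlock T ν₀ τ σ a z G u) (k : ℕ) :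
    switchTime T σ k = blowupTime T σ - σ ^ (2 * k) * blowupTime T σ := by
  have := blowupTime_sub_switchTime T h.σ_sq_lt_one.ne k
  linarith

/-- **Strip shift**: `T₀ - σ²s` lies in the `(j+1)`-st strip iff `T₀ - s` lies in the `j`-th.
[folklore] -/
theorem blowupTime_sub_mem_Ico_iff (h : IsSuperBlock T ν₀ τ σ a z G u) (s : ℝ) (j : ℕ) :
    blowupTime T σ - σ ^ 2 * s ∈ Ico (switchTime T σ (j + 1)) (switchTime T σ (j + 1 + 1)) ↔
      blowupTime T σ - s ∈ Ico (switchTime T σ j) (switchTime T σ (j + 1)) := by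
  have hσ2 : 0 < σ ^ 2 := pow_pos h.σ_pos 2
  simp only [mem_Ico, h.switchTime_eq_blowupTime_sub]
  have e1 : σ ^ (2 * (j + 1)) = σ ^ 2 * σ ^ (2 * j) := by ring
  have e2 : σ ^ (2 * (j + 1 + 1)) = σ ^ 2 * σ ^ (2 * (j + 1)) := by ring
  rw [e2, e1]
  constructor
  · rintro ⟨h1, h2⟩
    constructor <;> nlinarith
  · rintro ⟨h1, h2⟩
    constructor <;> nlinarith

/-- **Discrete Euler self-similarity of the super-cascade** about `(T₀, x₀)`,
`x₀ = blowupPoint τ z`: for every `s ≤ T₀` and `y`,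
`𝔲(T₀ - σ² s, x₀ + τ y) = a 𝔲(T₀ - s, x₀ + y)` — the `(j+1)`-st piece is the `j`-th one seen
through `(s, y) ↦ (σ² s, τ y)` and multiplied by `a`. [cite: Ozanski2017NSISingular, §2 (2.4)] -/
theorem glueG_eulerDSS (h : IsSuperBlock T ν₀ τ σ a z G u) {s : ℝ} (hs : s ≤ blowupTime T σ)
    (y : EuclideanSpace ℝ (Fin 3)) :
    glueG T σ τ a z u (blowupTime T σ - σ ^ 2 * s) (blowupPoint τ z + τ • y) =
      a • glueG T σ τ a z u (blowupTime T σ - s) (blowupPoint τ z + y) := by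
  have hT := h.T_pos
  have hσ := h.σ_pos
  rcases le_or_gt s 0 with hs0 | hs0
  · -- both times are `≥ T₀`: both sides vanish
    have h1 : blowupTime T σ ≤ blowupTime T σ - σ ^ 2 * s := by nlinarith [pow_pos hσ 2]
    have h2 : blowupTime T σ ≤ blowupTime T σ - s := by linarith
    rw [glueG_eq_zero_of_le hT hσ h.σ_lt_one τ a z u h1,
      glueG_eq_zero_of_le hT hσ h.σ_lt_one τ a z u h2]
    simp
  · -- `T₀ - s ∈ [0, T₀)` lies in some strip `j`; then `T₀ - σ²s` lies in strip `j+1`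
    have hblow : 0 < blowupTime T σ := div_pos hT (sub_pos.2 h.σ_sq_lt_one)
    obtain ⟨j, hj⟩ := exists_mem_Ico_switchTime hσ h.σ_lt_one (sub_nonneg.2 hs)
      (by linarith : blowupTime T σ - s < blowupTime T σ)
    have hj' := (h.blowupTime_sub_mem_Ico_iff s j).2 hj
    rw [glueG_eq_pieceG hT hσ τ a z u hj', glueG_eq_pieceG hT hσ τ a z u hj, pieceG_apply,
      pieceG_apply, smul_smul, ← pow_succ', blowupPoint]
    congr 2
    · -- local times agree
      rw [h.switchTime_eq_blowupTime_sub (j + 1), h.switchTime_eq_blowupTime_sub j]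
      have hσ2 : σ ^ 2 ≠ 0 := (pow_pos hσ 2).ne'
      have e1 : (σ⁻¹) ^ (2 * (j + 1)) = (σ⁻¹) ^ (2 * j) * (σ ^ 2)⁻¹ := by rw [← inv_pow]; ring
      rw [e1]
      field_simp
      ring
    · -- space points agree: `τ^{-(j+1)} (τ y) = τ^{-j} y`
      rw [add_sub_cancel_left, add_sub_cancel_left, smul_smul, pow_succ, mul_assoc,
        inv_mul_cancel₀ h.τ_pos.ne', mul_one]

/-- **The same in Seregin's exponents**: `τ^{1+ρ} 𝔲(T₀ - τ^{2+ρ} s, x₀ + τ y) = 𝔲(T₀ - s, x₀ + y)`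
for `s ≤ T₀` — invariance under the Euler scaling `v ↦ λ^{1+ρ} v(T₀ + λ^{2+ρ}(t - T₀), x₀ + λ(x - x₀))`
of exponent `ρ` at the discrete scale `λ = τ`, the symmetry group of the power-gauged class
(Seregin, arXiv:2402.13229, (1.7); arXiv:2409.07625, (3.1)). [folklore] -/
theorem glueG_eulerDSS_rpow (h : IsSuperBlock T ν₀ τ σ a z G u) (hρ : a = τ ^ (-(1 + ρ)))
    {s : ℝ} (hs : s ≤ blowupTime T σ) (y : EuclideanSpace ℝ (Fin 3)) :
    τ ^ (1 + ρ) • glueG T σ τ a z u (blowupTime T σ - τ ^ (2 + ρ) * s) (blowupPoint τ z + τ • y) =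
      glueG T σ τ a z u (blowupTime T σ - s) (blowupPoint τ z + y) := by
  rw [← h.σ_sq_eq_rpow hρ, h.glueG_eulerDSS hs, smul_smul, hρ, ← Real.rpow_add h.τ_pos,
    add_neg_cancel, Real.rpow_zero, one_smul]

/-- Iterated form: `𝔲(T₀ - σ^{2k} s, x₀ + τᵏ y) = aᵏ 𝔲(T₀ - s, x₀ + y)` for `s ≤ T₀`. [folklore] -/
theorem glueG_eulerDSS_iterate (h : IsSuperBlock T ν₀ τ σ a z G u) {s : ℝ}
    (hs : s ≤ blowupTime T σ) (y : EuclideanSpace ℝ (Fin 3)) (k : ℕ) :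
    glueG T σ τ a z u (blowupTime T σ - σ ^ (2 * k) * s) (blowupPoint τ z + τ ^ k • y) =
      a ^ k • glueG T σ τ a z u (blowupTime T σ - s) (blowupPoint τ z + y) := by
  induction k generalizing s y with
  | zero => simp
  | succ k ih =>
    have hs' : σ ^ 2 * s ≤ blowupTime T σ := by
      rcases le_or_gt s 0 with h0 | h0
      · have : σ ^ 2 * s ≤ 0 := mul_nonpos_of_nonneg_of_nonpos (pow_nonneg h.σ_pos.le 2) h0
        exact this.trans (div_pos h.T_pos (sub_pos.2 h.σ_sq_lt_one)).le
      · exact (mul_le_of_le_one_left h0.le h.σ_sq_lt_one.le).trans hs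
    have e1 : σ ^ (2 * (k + 1)) * s = σ ^ (2 * k) * (σ ^ 2 * s) := by ring
    have e2 : τ ^ (k + 1) • y = τ ^ k • (τ • y) := by rw [smul_smul, pow_succ]
    rw [e1, e2, ih hs' (τ • y), h.glueG_eulerDSS hs y, smul_smul, ← pow_succ]

end IsSuperBlock

end Summit.NavierStokesRegularity.NavierStokesRegularity.Theorems.TypeIliouvilleNoTypeIINegative

end
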